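import Literature.MathematicalPhysics.QuantumFieldTheory.MullerSchiemann1987.MS87NonperturbativeBound
import Literature.Barriers.QuantumFields.GrossWittenEquilibrium
import Literature.Analysis.Complex.SeparatelyHolomorphicStrips
import Mathlib.Analysis.Analytic.Order
import HarnessLib

/-!
# Müller–Schiemann, *Continuum limit of a hierarchical SU(2) lattice gauge theory in 4 dimensions*
# (CMP 110, 1987), FROM THE PROOF OF THEOREM 3 (p.283 L.19–21): «The limit Gibbs factor g^{(−n)}(u) has a zero
# set of Haar measure zero since this set consists at most of a finite number of conjugacy classes (h^{(−n)} can
# only have discrete zeros)» — PROVED: conjugacy classes of `SU(2)` (level sets of `u₀`), and countable unions of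
# them, are Haar-null; v1.1: zeros of a holomorphic `h` on a strip are countable (theorems only; no definition, no fact)

statement-level skeleton of published theorems with citation tags; proofs where landed; nothing here is a claim about the Yang–Mills mass gap

**Citation header (reproduction of PUBLISHED work).** V. F. Müller, J. Schiemann, *Continuum limit of a hierarchical
SU(2) lattice gauge theory in 4 dimensions*, Commun. Math. Phys. **110** (1987) 261–286, doi 10.1007/BF01207367
[MullerSchiemann1987]; (2.16)–(2.17) p.265 (class functions as functions of the central angle, `u₀ = cos θ`),
Theorem 3 p.282, its proof p.283 L.19–21 (held Project Euclid scan `paper:url-96df5da18d4c`; displays read by this seat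
on its own 3× page renders `run/shared/lean/pub/lit-balaban/lit-balaban-p12/renders-cmp110ms/ms87-cmp110-pdfp005,023-
journalp265,283-x3.png`). Lean lane of the lit-balaban YM LIT SWEEP CONTEXT row X1 (register level; zero weight for any
token of that table); the model is the `d = 4` HIERARCHICAL `SU(2)` gauge model, NOT lattice Yang–Mills.

**What the paper prints (p.283 L.19–21).** *«The limit Gibbs factor g^{(−n)}(u) has a zero set of Haar measure zero
since this set consists at most of a finite number of conjugacy classes (h^{(−n)} can only have discrete zeros).»*
(A class function on `G = SU(2)` is a function of `u₀ = ½ tr u = cos θ`, (2.16)–(2.17): `g(u) = h(θ)`; a conjugacy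
class is a level set `{u : u₀ = t}`.)

**What this file proves (kernel-checked, 0 sorry, standard axioms; no definition, no named fact).** With the tree's
normalised Haar measure `haarProbability SU(2)`, its exponential chart (`T4HaarSU2ExpChart.map_expPoint_expMeasure`:
Haar is the push-forward of the measure `(2π²)⁻¹ sinc²‖x‖ d³x` on `‖x‖ < π` under `x ↦ exp(ιx)`, with
`u₀(exp ιx) = cos‖x‖`, `MS87NonperturbativeBound.u0_expPoint`) and Mathlib's `Measure.addHaar_sphere`:
* §1 `{r : cos r ∈ Z}` (`Z` countable) is countable (`countable_setOf_cos_mem`, from the tree's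
  `Literature.Barriers.QuantumFields.countable_setOf_cos_eq` for a single level); `{x ∈ ℝ³ : ‖x‖ ∈ R}` (`R`
  countable) and `{x ∈ ℝ³ : cos‖x‖ ∈ Z}` are Lebesgue-null (`volume_setOf_norm_mem_eq_zero`,
  `volume_setOf_cos_norm_mem_eq_zero`);
* §2 **conjugacy classes are Haar-null**: `Haar{u ∈ SU(2) : u₀ ∈ Z} = 0` for every countable `Z ⊆ ℝ`
  (`haar_setOf_u0_mem_eq_zero`), in particular `Haar{u : u₀ = t} = 0` (`haar_setOf_u0_eq_eq_zero`);
* §3 **the sentence of L.19–21**: a class function `g(u) = H(u₀)` whose angular zero set `{x : H(cos x) = 0}` is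
  countable («h can only have discrete zeros») vanishes at most on a Haar-null set (`haar_zeroSet_comp_u0_eq_zero`);
  the same with a countable set `{t : H t = 0}` of zeros in the `u₀` variable (`haar_zeroSet_comp_u0_eq_zero'`).
* §4 (v1.1) **«h^{(−n)} can only have discrete zeros»**: a function holomorphic on a strip `{|Im z| < d}` and not
  identically zero has a countable zero set there (`countable_zeroSet_of_differentiableOn_strip`, Mathlib's
  isolated-zeros principle `AnalyticOnNhd.preimage_zero_mem_codiscreteWithin` + `IsLindelof.countable`), hence
  countably many real zeros (`countable_real_zeroSet_of_differentiableOn_strip`); so §3's hypothesis is DISCHARGED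
  for `g(u) = H(u₀)` with a holomorphic angular representative `h`, `h(x) = H(cos x)` on `ℝ`
  (`haar_zeroSet_eq_zero_of_holomorphic`).

**Readings / scope (declared).** (i) «finite number of conjugacy classes» is proved in the stronger countable form.
(ii) v1.0 took «countable angular zero set» as a hypothesis; §4 (v1.1) derives it for any `h` holomorphic on a strip
and not identically zero (the paper's `h^{(−n)}` is holomorphic on `|Im z| < d_n` with `h^{(−n)}(0) = 1`). (iii) Combined
with the sibling `MS87MigdalPositivity.pos_of_migdal_eq` this gives p.283 L.38–39 for `G = SU(2)`.

**Not claimed.** Theorem 3; anything about lattice Yang–Mills or the Clay problem.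
-/

open MeasureTheory Set Metric
open scoped ENNReal

namespace Literature.MathematicalPhysics.QuantumFieldTheory

namespace MullerSchiemann1987

namespace ConjugacyClassNull

open Literature.MathematicalPhysics.QuantumFieldTheory (haarProbability)
open Literature.MathematicalPhysics.QuantumFieldTheory.Balaban1983to89.T4HaarSU2ExpChart
  (expPoint expMeasure measurable_expPoint map_expPoint_expMeasure)
open HeatKernel (u0 continuous_u0 abs_u0_le_one)
open NonperturbativeBound (u0_expPoint)
open Literature.Barriers.QuantumFields (countable_setOf_cos_eq)

/-! ## §1 Countable sets of angles; spheres in `ℝ³` are Lebesgue-null -/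

/-- `{r : cos r ∈ Z}` is countable for countable `Z`. [cite: MullerSchiemann1987, p.283 L.19–21] -/
theorem countable_setOf_cos_mem {Z : Set ℝ} (hZ : Z.Countable) : {r : ℝ | Real.cos r ∈ Z}.Countable := by
  have e : {r : ℝ | Real.cos r ∈ Z} = ⋃ t ∈ Z, {r : ℝ | Real.cos r = t} := by
    ext r
    simp only [mem_setOf_eq, mem_iUnion, exists_prop, exists_eq_right']
  rw [e]
  exact hZ.biUnion fun t _ => countable_setOf_cos_eq t

/-- A countable union of spheres `{x ∈ ℝ³ : ‖x‖ ∈ R}` is Lebesgue-null (Mathlib's `Measure.addHaar_sphere`).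
[cite: MullerSchiemann1987, p.283 L.19–21] -/
theorem volume_setOf_norm_mem_eq_zero {R : Set ℝ} (hR : R.Countable) :
    volume {x : EuclideanSpace ℝ (Fin 3) | ‖x‖ ∈ R} = 0 := by
  have e : {x : EuclideanSpace ℝ (Fin 3) | ‖x‖ ∈ R} = ⋃ r ∈ R, sphere (0 : EuclideanSpace ℝ (Fin 3)) r := by
    ext x
    simp only [mem_setOf_eq, mem_iUnion, mem_sphere_zero_iff_norm, exists_prop, exists_eq_right']
  rw [e, measure_biUnion_null_iff hR]
  intro r _
  exact Measure.addHaar_sphere volume 0 r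

/-- `{x ∈ ℝ³ : cos‖x‖ ∈ Z}` is Lebesgue-null for countable `Z` (in the exponential chart these are the conjugacy
classes with `u₀ ∈ Z`). [cite: MullerSchiemann1987, p.283 L.19–21] -/
theorem volume_setOf_cos_norm_mem_eq_zero {Z : Set ℝ} (hZ : Z.Countable) :
    volume {x : EuclideanSpace ℝ (Fin 3) | Real.cos ‖x‖ ∈ Z} = 0 :=
  volume_setOf_norm_mem_eq_zero (R := {r : ℝ | Real.cos r ∈ Z}) (countable_setOf_cos_mem hZ)

/-! ## §2 Conjugacy classes of `SU(2)` are Haar-null -/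

/-- The chart measure `μ_exp = (2π²)⁻¹ sinc²‖x‖ d³x|_{‖x‖<π}` is absolutely continuous with respect to Lebesgue
measure. [cite: MullerSchiemann1987, p.283 L.19–21] -/
theorem expMeasure_absolutelyContinuous : expMeasure ≪ (volume : Measure (EuclideanSpace ℝ (Fin 3))) :=
  (withDensity_absolutelyContinuous _ _).trans (Measure.absolutelyContinuous_of_le Measure.restrict_le_self)

/-- **Conjugacy classes are Haar-null, countable form**: `Haar{u ∈ SU(2) : u₀(u) ∈ Z} = 0` for every countable
`Z ⊆ ℝ` (push the set forward through the exponential chart, where it is the null set `{cos‖x‖ ∈ Z}`).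
[cite: MullerSchiemann1987, p.283 L.19–21] -/
theorem haar_setOf_u0_mem_eq_zero {Z : Set ℝ} (hZ : Z.Countable) :
    haarProbability (Matrix.specialUnitaryGroup (Fin 2) ℂ) {U | u0 U ∈ Z} = 0 := by
  have hS : MeasurableSet {U : Matrix.specialUnitaryGroup (Fin 2) ℂ | u0 U ∈ Z} :=
    continuous_u0.measurable hZ.measurableSet
  rw [← map_expPoint_expMeasure, Measure.map_apply measurable_expPoint hS]
  have hpre : expPoint ⁻¹' {U : Matrix.specialUnitaryGroup (Fin 2) ℂ | u0 U ∈ Z} =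
      {x : EuclideanSpace ℝ (Fin 3) | Real.cos ‖x‖ ∈ Z} := by
    ext x
    simp only [mem_preimage, mem_setOf_eq, u0_expPoint]
  rw [hpre]
  exact expMeasure_absolutelyContinuous (volume_setOf_cos_norm_mem_eq_zero hZ)

/-- **A single conjugacy class `{u : u₀(u) = t}` is Haar-null.** [cite: MullerSchiemann1987, p.283 L.19–21] -/
theorem haar_setOf_u0_eq_eq_zero (t : ℝ) :
    haarProbability (Matrix.specialUnitaryGroup (Fin 2) ℂ) {U | u0 U = t} = 0 :=
  haar_setOf_u0_mem_eq_zero (Z := {t}) (Set.countable_singleton t)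

/-! ## §3 The sentence of p.283 L.19–21 -/

/-- **«The limit Gibbs factor g(u) has a zero set of Haar measure zero since this set consists at most of a finite
number of conjugacy classes (h can only have discrete zeros)»**: a class function `g(u) = H(u₀(u))` whose angular
zero set `{x : H(cos x) = 0}` is countable vanishes at most on a Haar-null set.
[cite: MullerSchiemann1987, Thm 3 proof p.283 L.19–21] -/
theorem haar_zeroSet_comp_u0_eq_zero {X : Type*} [Zero X] {H : ℝ → X}
    (hH : {x : ℝ | H (Real.cos x) = 0}.Countable) :
    haarProbability (Matrix.specialUnitaryGroup (Fin 2) ℂ) {U | H (u0 U) = 0} = 0 := by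
  refine measure_mono_null (fun U hU => ?_) (haar_setOf_u0_mem_eq_zero (hH.image Real.cos))
  have h1 := abs_le.mp (abs_u0_le_one U)
  refine ⟨Real.arccos (u0 U), ?_, Real.cos_arccos h1.1 h1.2⟩
  show H (Real.cos (Real.arccos (u0 U))) = 0
  rw [Real.cos_arccos h1.1 h1.2]
  exact hU

/-- The same with the zeros counted in the variable `u₀`: if `{t : H t = 0}` is countable then `g(u) = H(u₀(u))`
vanishes at most on a Haar-null set. [cite: MullerSchiemann1987, Thm 3 proof p.283 L.19–21] -/
theorem haar_zeroSet_comp_u0_eq_zero' {X : Type*} [Zero X] {H : ℝ → X} (hH : {t : ℝ | H t = 0}.Countable) :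
    haarProbability (Matrix.specialUnitaryGroup (Fin 2) ℂ) {U | H (u0 U) = 0} = 0 :=
  haar_setOf_u0_mem_eq_zero (Z := {t : ℝ | H t = 0}) hH

/-! ## §4 (v1.1) «h^{(−n)} can only have discrete zeros»: the real zero set of a function holomorphic on a strip
is countable, and the hypothesis of §3 is discharged

Mathlib's isolated-zeros principle in its codiscrete form (`AnalyticOnNhd.preimage_zero_mem_codiscreteWithin`) on the
connected open strip `{|Im z| < d}` (the tree's `Literature.Analysis.Complex.isPreconnected_setOf_abs_im_lt`), then:
a discrete subset of the second-countable `ℂ` is countable (`IsLindelof.countable`). -/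

open Literature.Analysis.Complex (isOpen_setOf_abs_im_lt isPreconnected_setOf_abs_im_lt)

/-- **Discrete zeros**: a function holomorphic on the strip `{|Im z| < d}` and not identically zero there has a
COUNTABLE zero set in the strip (its zeros are isolated). [cite: MullerSchiemann1987, Thm 3 proof p.283 L.20–21
(«h^{(−n)} can only have discrete zeros»)] -/
theorem countable_zeroSet_of_differentiableOn_strip {d : ℝ} {h : ℂ → ℂ}
    (hh : DifferentiableOn ℂ h {z : ℂ | |z.im| < d}) {z₀ : ℂ} (hz₀ : |z₀.im| < d) (hne : h z₀ ≠ 0) :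
    ({z : ℂ | |z.im| < d} ∩ h ⁻¹' {0}).Countable := by
  have hS : IsOpen {z : ℂ | |z.im| < d} := isOpen_setOf_abs_im_lt d
  have hconn : IsConnected {z : ℂ | |z.im| < d} := ⟨⟨z₀, hz₀⟩, isPreconnected_setOf_abs_im_lt d⟩
  have hcod : h ⁻¹' {0}ᶜ ∈ Filter.codiscreteWithin {z : ℂ | |z.im| < d} :=
    (hh.analyticOnNhd hS).preimage_zero_mem_codiscreteWithin hne hz₀ hconn
  have hdisc : IsDiscrete (h ⁻¹' {0} ∩ {z : ℂ | |z.im| < d}) := isDiscrete_of_codiscreteWithin hcod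
  rw [Set.inter_comm]
  exact (HereditarilyLindelofSpace.isLindelof _).countable (isDiscrete_iff_discreteTopology.mp hdisc)

/-- Hence the REAL zeros of such an `h` form a countable set. [cite: MullerSchiemann1987, Thm 3 proof p.283
L.20–21] -/
theorem countable_real_zeroSet_of_differentiableOn_strip {d : ℝ} (hd : 0 < d) {h : ℂ → ℂ}
    (hh : DifferentiableOn ℂ h {z : ℂ | |z.im| < d}) {z₀ : ℂ} (hz₀ : |z₀.im| < d) (hne : h z₀ ≠ 0) :
    {x : ℝ | h x = 0}.Countable := by
  have hsub : {x : ℝ | h x = 0} ⊆ ((↑) : ℝ → ℂ) ⁻¹' ({z : ℂ | |z.im| < d} ∩ h ⁻¹' {0}) := by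
    intro x hx
    refine ⟨?_, hx⟩
    show |(x : ℂ).im| < d
    rw [Complex.ofReal_im, abs_zero]
    exact hd
  exact ((countable_zeroSet_of_differentiableOn_strip hh hz₀ hne).preimage Complex.ofReal_injective).mono hsub

/-- **p.283 L.19–21 with its parenthesis discharged**: if the class function `g(u) = H(u₀(u))` has an angular
representative `h` — holomorphic on a strip `{|Im z| < d}`, not identically zero, with `h(x) = H(cos x)` for real
`x` ((2.16): `g(e^{−ixσ₃}) = h(x)`) — then `g` vanishes at most on a Haar-null subset of `SU(2)`.
[cite: MullerSchiemann1987, Thm 3 proof p.283 L.19–21, (2.16) p.265] -/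
theorem haar_zeroSet_eq_zero_of_holomorphic {d : ℝ} (hd : 0 < d) {H : ℝ → ℝ} {h : ℂ → ℂ}
    (hh : DifferentiableOn ℂ h {z : ℂ | |z.im| < d}) (hreal : ∀ x : ℝ, h x = (H (Real.cos x) : ℂ))
    {z₀ : ℂ} (hz₀ : |z₀.im| < d) (hne : h z₀ ≠ 0) :
    haarProbability (Matrix.specialUnitaryGroup (Fin 2) ℂ) {U | H (u0 U) = 0} = 0 := by
  refine haar_zeroSet_comp_u0_eq_zero ((countable_real_zeroSet_of_differentiableOn_strip hd hh hz₀ hne).mono ?_)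
  intro x hx
  show h x = 0
  rw [hreal x, (hx : H (Real.cos x) = 0), Complex.ofReal_zero]

end ConjugacyClassNull

end MullerSchiemann1987

end Literature.MathematicalPhysics.QuantumFieldTheory
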